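import Mathlib.Data.ENNReal.Inv
import Mathlib.Tactic.Ring
import HarnessLib

/-!
# Crux `TwoReplicaTransienceBound` (stmt-AtomisticToContinuum-9687): the insertion RECURSION

Support file (does not close the item) for the crux
`Summit.AtomisticToContinuum.BoseEinsteinCondensation.Theses.BECCutLineWeakDisorder.TwoReplicaTransienceBound`
(route `BECCutLineWeakDisorder`, line `SketchIdeator1`): the stub `stub_recursion` of the line's skeleton.

On short time windows the line controls the crux by an INSERTION RECURSION on the particle number `k`
at a fixed box and time: with `N k = ‖e^{-TH_k}1‖₂²` (all finite), `Θ` the one-free-line norm and `A`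
the insertion cost, the insertion step gives `Θ·N(k+1) ≤ N(k+2) + A·N k` for `k + 2 ≤ m`, and the base is
`Θ·N 0 ≤ N 1`. This file is the pure `[0, ∞]`-algebra induction concluding, under the smallness
condition `4A ≤ Θ²`, that `Θ·N k ≤ 2·N(k+1)` for all `k + 1 ≤ m` (`stub_recursion`).

Proof: induction on `k`. For `k = 0`, `Θ N₀ ≤ N₁ ≤ 2N₁`. For the step (`k + 2 ≤ m`, induction
hypothesis `Θ N_k ≤ 2N_{k+1}`), multiply the step inequality by `2Θ` and use the hypothesis and `4A ≤ Θ²`: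
`2Θ² N_{k+1} ≤ 2Θ N_{k+2} + 2A (Θ N_k) ≤ 2Θ N_{k+2} + 4A N_{k+1} ≤ 2Θ N_{k+2} + Θ² N_{k+1}`;
the finite term `Θ² N_{k+1}` cancels (`Θ ≠ ⊤`, `N_{k+1} ≠ ⊤`), leaving `Θ² N_{k+1} ≤ 2Θ N_{k+2}`, and
for `Θ ≠ 0` one factor `Θ` cancels (for `Θ = 0` the claim is trivial). No division is used.

Nothing here depends on the Feynman–Kac objects of the line: the statement is about an arbitrary
sequence `N : ℕ → ℝ≥0∞` of finite values; it is NOT the place where `Θ`, `A` or the insertion step are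
established (those are the neighbouring stubs of the skeleton).
-/

namespace Summit.AtomisticToContinuum.BoseEinsteinCondensation.Cruxes.TwoReplicaTransienceBound.TracerDecoupling

open scoped ENNReal

/-- **The insertion recursion** (pure `[0, ∞]` algebra). Let `N : ℕ → ℝ≥0∞` take finite values, let
`Θ ≠ ⊤` and `A` satisfy the smallness condition `4A ≤ Θ²`, and assume the base `Θ N₀ ≤ N₁` and the
steps `Θ N_{k+1} ≤ N_{k+2} + A N_k` for `k + 2 ≤ m`. Then `Θ N_k ≤ 2 N_{k+1}` for every `k + 1 ≤ m`.
Induction on `k`: the step multiplies the recursion by `2Θ`, bounds `2A(Θ N_k) ≤ 4A N_{k+1} ≤ Θ² N_{k+1}`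
by the induction hypothesis, cancels the finite `Θ² N_{k+1}` and then one factor `Θ` (if `Θ ≠ 0`). -/
theorem stub_recursion :
    ∀ (N : ℕ → ENNReal) (Θ A : ENNReal) (m : ℕ), Θ ≠ ⊤ → (∀ k, N k ≠ ⊤) →
      Θ * N 0 ≤ N 1 → (∀ k, k + 2 ≤ m → Θ * N (k + 1) ≤ N (k + 2) + A * N k) → 4 * A ≤ Θ ^ 2 →
      ∀ k, k + 1 ≤ m → Θ * N k ≤ 2 * N (k + 1) := by
  intro N Θ A m hΘ hN h0 hstep hA k
  induction k with
  | zero =>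
    intro _
    calc Θ * N 0 ≤ N 1 := h0
      _ ≤ N 1 + N 1 := le_self_add
      _ = 2 * N 1 := (two_mul _).symm
  | succ k ih =>
    intro hk
    show Θ * N (k + 1) ≤ 2 * N (k + 2)
    have ih' : Θ * N k ≤ 2 * N (k + 1) := ih (by omega)
    have hs : Θ * N (k + 1) ≤ N (k + 2) + A * N k := hstep k (by omega)
    -- `2Θ² N_{k+1} ≤ 2Θ N_{k+2} + Θ² N_{k+1}`
    have h1 : Θ ^ 2 * N (k + 1) + Θ ^ 2 * N (k + 1) ≤ 2 * Θ * N (k + 2) + Θ ^ 2 * N (k + 1) :=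
      calc Θ ^ 2 * N (k + 1) + Θ ^ 2 * N (k + 1) = 2 * Θ * (Θ * N (k + 1)) := by ring
        _ ≤ 2 * Θ * (N (k + 2) + A * N k) := mul_le_mul' le_rfl hs
        _ = 2 * Θ * N (k + 2) + 2 * A * (Θ * N k) := by ring
        _ ≤ 2 * Θ * N (k + 2) + 2 * A * (2 * N (k + 1)) :=
          add_le_add le_rfl (mul_le_mul' le_rfl ih')
        _ = 2 * Θ * N (k + 2) + 4 * A * N (k + 1) := by ring
        _ ≤ 2 * Θ * N (k + 2) + Θ ^ 2 * N (k + 1) := add_le_add le_rfl (mul_le_mul' hA le_rfl)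
    have hfin : Θ ^ 2 * N (k + 1) ≠ ⊤ := ENNReal.mul_ne_top (ENNReal.pow_ne_top hΘ) (hN _)
    -- cancel the finite `Θ² N_{k+1}`
    have h2 : Θ ^ 2 * N (k + 1) ≤ 2 * Θ * N (k + 2) := (ENNReal.add_le_add_iff_right hfin).1 h1
    by_cases hΘ0 : Θ = 0
    · simp [hΘ0]
    -- cancel one factor `Θ`
    have h3 : Θ * (Θ * N (k + 1)) ≤ Θ * (2 * N (k + 2)) :=
      calc Θ * (Θ * N (k + 1)) = Θ ^ 2 * N (k + 1) := by ring
        _ ≤ 2 * Θ * N (k + 2) := h2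
        _ = Θ * (2 * N (k + 2)) := by ring
    exact (ENNReal.mul_le_mul_iff_right hΘ0 hΘ).1 h3

end Summit.AtomisticToContinuum.BoseEinsteinCondensation.Cruxes.TwoReplicaTransienceBound.TracerDecoupling
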